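import Summits.ResolutionOfSingularities.ResolutionOfSingularities.Theorems.FrobeniusLadderFInjectiveMacaulayficationSpecimenDoor
import Summits.ResolutionOfSingularities.ResolutionOfSingularities.Theorems.FrobeniusLadderFInjectiveMacaulayficationT11SpecimenDoor
import Summits.ResolutionOfSingularities.ResolutionOfSingularities.Theorems.FrobeniusLadderFInjectiveMacaulayficationCIJacobian
import Summits.ResolutionOfSingularities.ResolutionOfSingularities.Theorems.FrobeniusLadderFInjectiveMacaulayficationFcuspOffCurve
import Summits.ResolutionOfSingularities.ResolutionOfSingularities.Theorems.FrobeniusLadderFInjectiveMacaulayficationQuotientOriginMaximal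
import Mathlib.Algebra.MvPolynomial.PDeriv
import HarnessLib

/-!
# THE SPECIMEN DOOR FOR `T₁₁⁺` IN EVERY CHARACTERISTIC `p ∉ {2, 3, 7, 11}` (there the c.i. `V(Φ−y²−x³, z²+Φ³+x¹¹+w⁷) ⊂ 𝔸⁵` is REGULAR OFF
# THE ORIGIN), IN PARTICULAR `p = 5`: the crux conclusion for `T₁₁⁺` modulo point-fixability at the origin
# (crux `FrobeniusLadder.FInjectiveMacaulayfication` stmt-ResolutionOfSingularities-15315, chain w45a, road B, instance-ledger I13 = the T₁₁/5 twin;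
# res-L1-w45a-plan-1 GO 2026-08-27T10:42:50Z; seat res-L1-w45a-stub-2)

[OURS · L1 W4.5a] AI-written; AI review is weaker than expert review. NOT a statement of any manuscript; no named fact.

`F₀ = Φ − y² − x³`, `F₁ = z² + Φ³ + x¹¹ + w⁷` in `k[x,y,z,w,Φ] = MvPolynomial (Fin 5) k` (order `(x,y,z,w,Φ) = (X 0,…,X 4)`, the conventions of
`T11PlusPrime` / `T11PlusOffStratum` / `T11SpecimenDoor`). In characteristic `7` the `w`-derivative `7w⁶` vanishes identically and `T₁₁⁺` has a far
singular (F-pure) circle, handled by Fedder in `T11PlusOffStratum` (stub-4). In every characteristic `p ∉ {2, 3, 7, 11}` — in particular `p = 5` —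
the four `2 × 2` minors of `∂(F₀,F₁)` through the `Φ`-column,
`(∂_z,∂_Φ) ↦ −2z`, `(∂_w,∂_Φ) ↦ −7w⁶`, `(∂_y,∂_Φ) ↦ −6yΦ²`, `(∂_x,∂_Φ) ↦ −9x²Φ² − 11x¹⁰`,
cannot all lie in a prime `P ⊇ (F₀, F₁)` missing a variable (`exists_det_not_mem`: they force `z, w ∈ P` and `y ∈ P ∨ Φ ∈ P`; `Φ ∈ P ⇒ x, y ∈ P`;
else `y ∈ P`, `Φ ≡ x³`, `x⁸(9 + 11x²) ∈ P` and `x⁹(1 + x²) ∈ P` give `2 ∈ P`), so `T₁₁⁺` is regular at every point other than the origin and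
stub-6's `CIJacobian.ci_clause_of_det_not_mem` yields the per-stalk clause of the crux there:

* `det_z`, `det_w`, `det_y`, `det_x` — the four minors;
* `exists_det_not_mem` — some minor is not in `P`;
* `t11Plus_hoff_of_ne` — **the `hoff` binder of the generic specimen door `SpecimenDoor.fInjectiveMacaulayfication_of_originPointFixable`
  for `T₁₁⁺`**, any prime `p ∉ {2, 3, 7, 11}`: at every maximal `Q` of `k[X]/(Fs)` missing some `x̄ⱼ`, every system of parameters of the local
  ring is weakly regular and generates a Frobenius-closed ideal;
* `t11Plus_hoff_char5` — the instance `p = 5`;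
* `fInjectiveMacaulayfication_T11plus_of_ne` — **THE DOOR**: for `p ∉ {2, 3, 7, 11}`, if the stalk at the origin is point-fixable (`h0`, the `PFix_p`
  text of the generic door `SpecimenDoor.fInjectiveMacaulayfication_of_originPointFixable`, stub-3 p519463), then `X = T₁₁⁺/k` has a proper birational
  model all of whose stalks are domains with the Cohen–Macaulay + Frobenius-closed-parameter-ideals clause — generic door ∘ (`hprime` =
  `T11PlusPrime.t11plus_prime_and_X_ne_zero`, `h𝔪` = `QuotientOriginMaximal`, `hoff` = §3, `hCM` = `T11SpecimenDoor.cmClause_of_isMaximal`, char-free);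
* `fInjectiveMacaulayfication_T11plus_char5_of_h0` — the instance `p = 5` (the twin of `T11SpecimenDoor.fInjectiveMacaulayfication_T11plus_char7`).

No definitions, no named facts. [cite: Matsumura1987, Thm. 30.4 (ii), Thm. 14.2, Thm. 17.4, Thm. 21.2]
-/

set_option linter.dupNamespace false

noncomputable section

namespace Summit.ResolutionOfSingularities.ResolutionOfSingularities.Theorems.FInjectiveMacaulayfication.T11SpecimenDoorGeneric

open MvPolynomial AlgebraicGeometry
open Summit.ResolutionOfSingularities.ResolutionOfSingularities.Theorems.FInjectiveMacaulayfication

variable {k : Type} [Field k]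

/-! ## §1 The four minors of the Jacobian of `(F₀, F₁)` through the `Φ`-column -/

/-- `(∂_z, ∂_Φ)`-minor: `−2z`. [folklore] -/
theorem det_z (Fs : Fin 2 → MvPolynomial (Fin 5) k)
    (hF₀ : Fs 0 = X 4 - X 1 ^ 2 - X 0 ^ 3) (hF₁ : Fs 1 = X 2 ^ 2 + X 4 ^ 3 + X 0 ^ 11 + X 3 ^ 7) :
    (Matrix.of fun i j => (![(pderiv 2).restrictScalars ℤ, (pderiv 4).restrictScalars ℤ] :
      Fin 2 → Derivation ℤ (MvPolynomial (Fin 5) k) (MvPolynomial (Fin 5) k)) i (Fs j)).det = C (-2) * X 2 := by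
  rw [Matrix.det_fin_two]
  simp only [Matrix.of_apply, Matrix.cons_val_zero, Matrix.cons_val_one, Derivation.restrictScalars_apply, hF₀, hF₁,
    map_add, map_sub, Derivation.leibniz_pow, pderiv_X_self, pderiv_X_of_ne (show (4 : Fin 5) ≠ 2 by decide),
    pderiv_X_of_ne (show (0 : Fin 5) ≠ 2 by decide), pderiv_X_of_ne (show (1 : Fin 5) ≠ 2 by decide),
    pderiv_X_of_ne (show (3 : Fin 5) ≠ 2 by decide), pderiv_X_of_ne (show (1 : Fin 5) ≠ 4 by decide),
    pderiv_X_of_ne (show (0 : Fin 5) ≠ 4 by decide), pderiv_X_of_ne (show (2 : Fin 5) ≠ 4 by decide),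
    pderiv_X_of_ne (show (3 : Fin 5) ≠ 4 by decide), smul_eq_mul, mul_one, nsmul_eq_mul, map_neg, map_ofNat]
  norm_num

/-- `(∂_w, ∂_Φ)`-minor: `−7w⁶`. [folklore] -/
theorem det_w (Fs : Fin 2 → MvPolynomial (Fin 5) k)
    (hF₀ : Fs 0 = X 4 - X 1 ^ 2 - X 0 ^ 3) (hF₁ : Fs 1 = X 2 ^ 2 + X 4 ^ 3 + X 0 ^ 11 + X 3 ^ 7) :
    (Matrix.of fun i j => (![(pderiv 3).restrictScalars ℤ, (pderiv 4).restrictScalars ℤ] :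
      Fin 2 → Derivation ℤ (MvPolynomial (Fin 5) k) (MvPolynomial (Fin 5) k)) i (Fs j)).det = C (-7) * X 3 ^ 6 := by
  rw [Matrix.det_fin_two]
  simp only [Matrix.of_apply, Matrix.cons_val_zero, Matrix.cons_val_one, Derivation.restrictScalars_apply, hF₀, hF₁,
    map_add, map_sub, Derivation.leibniz_pow, pderiv_X_self, pderiv_X_of_ne (show (4 : Fin 5) ≠ 3 by decide),
    pderiv_X_of_ne (show (0 : Fin 5) ≠ 3 by decide), pderiv_X_of_ne (show (1 : Fin 5) ≠ 3 by decide),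
    pderiv_X_of_ne (show (2 : Fin 5) ≠ 3 by decide), pderiv_X_of_ne (show (1 : Fin 5) ≠ 4 by decide),
    pderiv_X_of_ne (show (0 : Fin 5) ≠ 4 by decide), pderiv_X_of_ne (show (2 : Fin 5) ≠ 4 by decide),
    pderiv_X_of_ne (show (3 : Fin 5) ≠ 4 by decide), smul_eq_mul, mul_one, nsmul_eq_mul, map_neg, map_ofNat]
  norm_num

/-- `(∂_y, ∂_Φ)`-minor: `−6yΦ²` (as in `T11PlusOffStratum.clause_of_x_mem_P_not_mem`). [folklore] -/
theorem det_y (Fs : Fin 2 → MvPolynomial (Fin 5) k)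
    (hF₀ : Fs 0 = X 4 - X 1 ^ 2 - X 0 ^ 3) (hF₁ : Fs 1 = X 2 ^ 2 + X 4 ^ 3 + X 0 ^ 11 + X 3 ^ 7) :
    (Matrix.of fun i j => (![(pderiv 1).restrictScalars ℤ, (pderiv 4).restrictScalars ℤ] :
      Fin 2 → Derivation ℤ (MvPolynomial (Fin 5) k) (MvPolynomial (Fin 5) k)) i (Fs j)).det = C (-6) * X 1 * X 4 ^ 2 := by
  rw [Matrix.det_fin_two]
  simp only [Matrix.of_apply, Matrix.cons_val_zero, Matrix.cons_val_one, Derivation.restrictScalars_apply, hF₀, hF₁,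
    map_add, map_sub, Derivation.leibniz_pow, pderiv_X_self, pderiv_X_of_ne (show (4 : Fin 5) ≠ 1 by decide),
    pderiv_X_of_ne (show (0 : Fin 5) ≠ 1 by decide), pderiv_X_of_ne (show (2 : Fin 5) ≠ 1 by decide),
    pderiv_X_of_ne (show (3 : Fin 5) ≠ 1 by decide), pderiv_X_of_ne (show (1 : Fin 5) ≠ 4 by decide),
    pderiv_X_of_ne (show (0 : Fin 5) ≠ 4 by decide), pderiv_X_of_ne (show (2 : Fin 5) ≠ 4 by decide),
    pderiv_X_of_ne (show (3 : Fin 5) ≠ 4 by decide), smul_eq_mul, mul_one, nsmul_eq_mul, map_neg, map_ofNat]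
  norm_num
  ring

/-- `(∂_x, ∂_Φ)`-minor: `−9x²Φ² − 11x¹⁰`. [folklore] -/
theorem det_x (Fs : Fin 2 → MvPolynomial (Fin 5) k)
    (hF₀ : Fs 0 = X 4 - X 1 ^ 2 - X 0 ^ 3) (hF₁ : Fs 1 = X 2 ^ 2 + X 4 ^ 3 + X 0 ^ 11 + X 3 ^ 7) :
    (Matrix.of fun i j => (![(pderiv 0).restrictScalars ℤ, (pderiv 4).restrictScalars ℤ] :
      Fin 2 → Derivation ℤ (MvPolynomial (Fin 5) k) (MvPolynomial (Fin 5) k)) i (Fs j)).det =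
      C (-9) * X 0 ^ 2 * X 4 ^ 2 + C (-11) * X 0 ^ 10 := by
  rw [Matrix.det_fin_two]
  simp only [Matrix.of_apply, Matrix.cons_val_zero, Matrix.cons_val_one, Derivation.restrictScalars_apply, hF₀, hF₁,
    map_add, map_sub, Derivation.leibniz_pow, pderiv_X_self, pderiv_X_of_ne (show (4 : Fin 5) ≠ 0 by decide),
    pderiv_X_of_ne (show (1 : Fin 5) ≠ 0 by decide), pderiv_X_of_ne (show (2 : Fin 5) ≠ 0 by decide),
    pderiv_X_of_ne (show (3 : Fin 5) ≠ 0 by decide), pderiv_X_of_ne (show (1 : Fin 5) ≠ 4 by decide),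
    pderiv_X_of_ne (show (0 : Fin 5) ≠ 4 by decide), pderiv_X_of_ne (show (2 : Fin 5) ≠ 4 by decide),
    pderiv_X_of_ne (show (3 : Fin 5) ≠ 4 by decide), smul_eq_mul, mul_one, nsmul_eq_mul, map_neg, map_ofNat]
  norm_num
  ring

/-! ## §2 Off the origin some minor is a unit at the point -/

/-- A constant `C a`, `a ≠ 0`, is not in a proper ideal. [folklore] -/
theorem C_not_mem {P : Ideal (MvPolynomial (Fin 5) k)} (hP : P ≠ ⊤) {a : k} (ha : a ≠ 0) : (C a : MvPolynomial (Fin 5) k) ∉ P :=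
  fun h => hP (Ideal.eq_top_of_isUnit_mem _ h ((isUnit_iff_ne_zero.mpr ha).map C))

/-- **Off the origin, one of the four minors is not in `P`** (`P ⊇ (F₀, F₁)` prime, some variable `∉ P`), provided `2, 3, 7, 11 ≠ 0` in `k`.
[folklore] -/
theorem exists_det_not_mem (h2 : (2 : k) ≠ 0) (h3 : (3 : k) ≠ 0) (h7 : (7 : k) ≠ 0) (h11 : (11 : k) ≠ 0) (Fs : Fin 2 → MvPolynomial (Fin 5) k)
    (hF₀ : Fs 0 = X 4 - X 1 ^ 2 - X 0 ^ 3) (hF₁ : Fs 1 = X 2 ^ 2 + X 4 ^ 3 + X 0 ^ 11 + X 3 ^ 7)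
    (P : Ideal (MvPolynomial (Fin 5) k)) [hP : P.IsPrime] (hF₀P : Fs 0 ∈ P) (hF₁P : Fs 1 ∈ P)
    (hj : ∃ j : Fin 5, (X j : MvPolynomial (Fin 5) k) ∉ P) :
    ∃ D : Fin 2 → Derivation ℤ (MvPolynomial (Fin 5) k) (MvPolynomial (Fin 5) k), (Matrix.of fun i j => D i (Fs j)).det ∉ P := by
  by_contra hcon
  push Not at hcon
  have hz : (X 2 : MvPolynomial (Fin 5) k) ∈ P := by
    have h := hcon ![(pderiv 2).restrictScalars ℤ, (pderiv 4).restrictScalars ℤ]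
    rw [det_z Fs hF₀ hF₁] at h
    exact ((hP.mem_or_mem h).resolve_left (C_not_mem hP.ne_top (neg_ne_zero.mpr h2)))
  have hw : (X 3 : MvPolynomial (Fin 5) k) ∈ P := by
    have h := hcon ![(pderiv 3).restrictScalars ℤ, (pderiv 4).restrictScalars ℤ]
    rw [det_w Fs hF₀ hF₁] at h
    exact hP.mem_of_pow_mem 6 ((hP.mem_or_mem h).resolve_left (C_not_mem hP.ne_top (neg_ne_zero.mpr h7)))
  have hyΦ : (X 1 : MvPolynomial (Fin 5) k) ∈ P ∨ (X 4 : MvPolynomial (Fin 5) k) ∈ P := by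
    have h := hcon ![(pderiv 1).restrictScalars ℤ, (pderiv 4).restrictScalars ℤ]
    rw [det_y Fs hF₀ hF₁] at h
    have h6 : (-6 : k) ≠ 0 := by
      rw [neg_ne_zero, show (6 : k) = 2 * 3 by norm_num]
      exact mul_ne_zero h2 h3
    rcases hP.mem_or_mem h with h1 | h1
    · rcases hP.mem_or_mem h1 with h0 | h0
      · exact absurd h0 (C_not_mem hP.ne_top h6)
      · exact Or.inl h0
    · exact Or.inr (hP.mem_of_pow_mem 2 h1)
  have hx' : (C (-9) * X 0 ^ 2 * X 4 ^ 2 + C (-11) * X 0 ^ 10 : MvPolynomial (Fin 5) k) ∈ P := by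
    have h := hcon ![(pderiv 0).restrictScalars ℤ, (pderiv 4).restrictScalars ℤ]
    rwa [det_x Fs hF₀ hF₁] at h
  rcases hyΦ with hy | hΦ
  · -- `y ∈ P`: `Φ ≡ x³`, then `x⁸ (9 + 11 x²) ∈ P` and `x⁹ (1 + x²) ∈ P` force `2 ∈ P`
    by_cases hΦ : (X 4 : MvPolynomial (Fin 5) k) ∈ P
    · -- then all variables are in `P`
      have hx : (X 0 : MvPolynomial (Fin 5) k) ∈ P := by
        have h10 : (C (-11) * X 0 ^ 10 : MvPolynomial (Fin 5) k) ∈ P := by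
          have : (C (-11) * X 0 ^ 10 : MvPolynomial (Fin 5) k) =
              (C (-9) * X 0 ^ 2 * X 4 ^ 2 + C (-11) * X 0 ^ 10) - C (-9) * X 0 ^ 2 * X 4 * X 4 := by ring
          rw [this]
          exact sub_mem hx' (Ideal.mul_mem_left _ _ hΦ)
        exact hP.mem_of_pow_mem 10 ((hP.mem_or_mem h10).resolve_left (C_not_mem hP.ne_top (neg_ne_zero.mpr h11)))
      obtain ⟨j, hj⟩ := hj
      apply hj
      fin_cases j
      · exact hx
      · exact hy
      · exact hz
      · exact hw
      · exact hΦ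
    · have hx : (X 0 : MvPolynomial (Fin 5) k) ∉ P := by
        intro hx
        apply hΦ
        have : (X 4 : MvPolynomial (Fin 5) k) = Fs 0 + X 1 * X 1 + X 0 * X 0 ^ 2 := by rw [hF₀]; ring
        rw [this]
        exact add_mem (add_mem hF₀P (Ideal.mul_mem_right _ _ hy)) (Ideal.mul_mem_right _ _ hx)
      -- `Φ − x³ ∈ P`
      have hΦx : (X 4 - X 0 ^ 3 : MvPolynomial (Fin 5) k) ∈ P := by
        have : (X 4 - X 0 ^ 3 : MvPolynomial (Fin 5) k) = Fs 0 + X 1 * X 1 := by rw [hF₀]; ring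
        rw [this]
        exact add_mem hF₀P (Ideal.mul_mem_right _ _ hy)
      -- `x⁸ (9 + 11 x²) ∈ P`
      have hA : (X 0 ^ 8 * (C 9 + C 11 * X 0 ^ 2) : MvPolynomial (Fin 5) k) ∈ P := by
        have : (X 0 ^ 8 * (C 9 + C 11 * X 0 ^ 2) : MvPolynomial (Fin 5) k) =
            -(C (-9) * X 0 ^ 2 * X 4 ^ 2 + C (-11) * X 0 ^ 10) - C 9 * X 0 ^ 2 * (X 4 + X 0 ^ 3) * (X 4 - X 0 ^ 3) := by
          simp only [map_neg]
          ring
        rw [this]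
        exact sub_mem (neg_mem hx') (Ideal.mul_mem_left _ _ hΦx)
      have hA' : (C 9 + C 11 * X 0 ^ 2 : MvPolynomial (Fin 5) k) ∈ P :=
        (hP.mem_or_mem hA).resolve_left fun h => hx (hP.mem_of_pow_mem 8 h)
      -- `x⁹ (1 + x²) ∈ P`
      have hB : (X 0 ^ 9 * (1 + X 0 ^ 2) : MvPolynomial (Fin 5) k) ∈ P := by
        have : (X 0 ^ 9 * (1 + X 0 ^ 2) : MvPolynomial (Fin 5) k) =
            Fs 1 - X 2 * X 2 - X 3 * X 3 ^ 6 - (X 4 ^ 2 + X 4 * X 0 ^ 3 + X 0 ^ 6) * (X 4 - X 0 ^ 3) := by rw [hF₁]; ring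
        rw [this]
        exact sub_mem (sub_mem (sub_mem hF₁P (Ideal.mul_mem_right _ _ hz)) (Ideal.mul_mem_right _ _ hw))
          (Ideal.mul_mem_left _ _ hΦx)
      have hB' : (1 + X 0 ^ 2 : MvPolynomial (Fin 5) k) ∈ P :=
        (hP.mem_or_mem hB).resolve_left fun h => hx (hP.mem_of_pow_mem 9 h)
      -- `2 = 11 (1 + x²) − (9 + 11 x²)`
      have h2P : (C 2 : MvPolynomial (Fin 5) k) ∈ P := by
        have : (C 2 : MvPolynomial (Fin 5) k) = C 11 * (1 + X 0 ^ 2) - (C 9 + C 11 * X 0 ^ 2) := by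
          rw [show (2 : k) = 11 - 9 by norm_num, map_sub]
          ring
        rw [this]
        exact sub_mem (Ideal.mul_mem_left _ _ hB') hA'
      exact C_not_mem hP.ne_top h2 h2P
  · -- `Φ ∈ P`: then `x ∈ P` (from the `x`-minor) and `y ∈ P` (from `F₀`), so every variable is in `P`
    have hx : (X 0 : MvPolynomial (Fin 5) k) ∈ P := by
      have h10 : (C (-11) * X 0 ^ 10 : MvPolynomial (Fin 5) k) ∈ P := by
        have : (C (-11) * X 0 ^ 10 : MvPolynomial (Fin 5) k) =
            (C (-9) * X 0 ^ 2 * X 4 ^ 2 + C (-11) * X 0 ^ 10) - C (-9) * X 0 ^ 2 * X 4 * X 4 := by ring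
        rw [this]
        exact sub_mem hx' (Ideal.mul_mem_left _ _ hΦ)
      exact hP.mem_of_pow_mem 10 ((hP.mem_or_mem h10).resolve_left (C_not_mem hP.ne_top (neg_ne_zero.mpr h11)))
    have hy : (X 1 : MvPolynomial (Fin 5) k) ∈ P := by
      have h : (X 1 ^ 2 : MvPolynomial (Fin 5) k) ∈ P := by
        have : (X 1 ^ 2 : MvPolynomial (Fin 5) k) = X 4 - X 0 * X 0 ^ 2 - Fs 0 := by rw [hF₀]; ring
        rw [this]
        exact sub_mem (sub_mem hΦ (Ideal.mul_mem_right _ _ hx)) hF₀P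
      exact hP.mem_of_pow_mem 2 h
    obtain ⟨j, hj⟩ := hj
    apply hj
    fin_cases j
    · exact hx
    · exact hy
    · exact hz
    · exact hw
    · exact hΦ

/-! ## §3 The `hoff` binder of the generic specimen door -/

/-- **`hoff` FOR `T₁₁⁺`, ANY PRIME `p ∉ {2, 3, 7, 11}`** — the hypothesis `hoff` of `SpecimenDoor.fInjectiveMacaulayfication_of_originPointFixable`
for `Fs 0 = Φ − y² − x³`, `Fs 1 = z² + Φ³ + x¹¹ + w⁷`: at every maximal ideal `Q` of `k[X]/(Fs)` missing some `x̄ⱼ` the local ring is regular,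
hence every system of parameters is weakly regular and generates a Frobenius-closed ideal (`CIJacobian.ci_clause_of_det_not_mem`).
[cite: Matsumura1987, Thm. 30.4 (ii) and Thm. 14.2] -/
theorem t11Plus_hoff_of_ne (p : ℕ) [Fact p.Prime] (hp2 : p ≠ 2) (hp3 : p ≠ 3) (hp7 : p ≠ 7) (hp11 : p ≠ 11) (k : Type) [Field k] [CharP k p]
    (Fs : Fin 2 → MvPolynomial (Fin 5) k)
    (hF₀ : Fs 0 = X 4 - X 1 ^ 2 - X 0 ^ 3) (hF₁ : Fs 1 = X 2 ^ 2 + X 4 ^ 3 + X 0 ^ 11 + X 3 ^ 7) :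
    ∀ (Q : Ideal (MvPolynomial (Fin 5) k ⧸ Ideal.span (Set.range Fs))) [Q.IsMaximal],
      (∃ j : Fin 5, Ideal.Quotient.mk (Ideal.span (Set.range Fs)) (X j) ∉ Q) →
      ∀ d : ℕ, ringKrullDim (Localization.AtPrime Q) = d → ∀ s : Fin d → Localization.AtPrime Q,
        (Ideal.span (Set.range s)).radical.IsMaximal →
          RingTheory.Sequence.IsWeaklyRegular (Localization.AtPrime Q) (List.ofFn s) ∧
          ∀ y : Localization.AtPrime Q, (∃ e : ℕ, y ^ p ^ e ∈ Ideal.span ((fun z : Localization.AtPrime Q => z ^ p ^ e) ''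
            (Ideal.span (Set.range s) : Set (Localization.AtPrime Q)))) → y ∈ Ideal.span (Set.range s) := by
  intro Q hQ hj
  set P := Q.comap (Ideal.Quotient.mk (Ideal.span (Set.range Fs))) with hPdef
  haveI : P.IsPrime := Ideal.comap_isPrime _ _
  have hFP : ∀ l : Fin 2, Fs l ∈ P := fun l => by
    rw [hPdef, Ideal.mem_comap, Ideal.Quotient.eq_zero_iff_mem.mpr (Ideal.subset_span (Set.mem_range_self l))]
    exact Q.zero_mem
  have hj' : ∃ j : Fin 5, (X j : MvPolynomial (Fin 5) k) ∉ P := by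
    obtain ⟨j, hj⟩ := hj
    exact ⟨j, fun h => hj (Ideal.mem_comap.mp h)⟩
  have h2 : (2 : k) ≠ 0 := by exact_mod_cast FcuspOffCurve.natCast_prime_ne_zero_of_charP_ne (k := k) p 2 Nat.prime_two hp2
  have h3 : (3 : k) ≠ 0 := by exact_mod_cast FcuspOffCurve.natCast_prime_ne_zero_of_charP_ne (k := k) p 3 Nat.prime_three hp3
  have h7 : (7 : k) ≠ 0 := by exact_mod_cast FcuspOffCurve.natCast_prime_ne_zero_of_charP_ne (k := k) p 7 (by norm_num) hp7
  have h11 : (11 : k) ≠ 0 := by exact_mod_cast FcuspOffCurve.natCast_prime_ne_zero_of_charP_ne (k := k) p 11 (by norm_num) hp11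
  obtain ⟨D, hD⟩ := exists_det_not_mem h2 h3 h7 h11 Fs hF₀ hF₁ P (hFP 0) (hFP 1) hj'
  exact (CIJacobian.ci_clause_of_det_not_mem p k 5 2 Fs Q D hD).2.2.1

/-- **`hoff` FOR `T₁₁⁺` AT `p = 5`** (the I13 instance). [cite: Matsumura1987, Thm. 30.4 (ii) and Thm. 14.2] -/
theorem t11Plus_hoff_char5 (k : Type) [Field k] [CharP k 5] (Fs : Fin 2 → MvPolynomial (Fin 5) k)
    (hF₀ : Fs 0 = X 4 - X 1 ^ 2 - X 0 ^ 3) (hF₁ : Fs 1 = X 2 ^ 2 + X 4 ^ 3 + X 0 ^ 11 + X 3 ^ 7) :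
    ∀ (Q : Ideal (MvPolynomial (Fin 5) k ⧸ Ideal.span (Set.range Fs))) [Q.IsMaximal],
      (∃ j : Fin 5, Ideal.Quotient.mk (Ideal.span (Set.range Fs)) (X j) ∉ Q) →
      ∀ d : ℕ, ringKrullDim (Localization.AtPrime Q) = d → ∀ s : Fin d → Localization.AtPrime Q,
        (Ideal.span (Set.range s)).radical.IsMaximal →
          RingTheory.Sequence.IsWeaklyRegular (Localization.AtPrime Q) (List.ofFn s) ∧
          ∀ y : Localization.AtPrime Q, (∃ e : ℕ, y ^ 5 ^ e ∈ Ideal.span ((fun z : Localization.AtPrime Q => z ^ 5 ^ e) ''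
            (Ideal.span (Set.range s) : Set (Localization.AtPrime Q)))) → y ∈ Ideal.span (Set.range s) :=
  haveI : Fact (Nat.Prime 5) := ⟨by norm_num⟩
  t11Plus_hoff_of_ne 5 (by norm_num) (by norm_num) (by norm_num) (by norm_num) k Fs hF₀ hF₁

/-! ## §4 The specimen door for `T₁₁⁺`, `p ∉ {2, 3, 7, 11}` -/

/-- `F₀(0) = F₁(0) = 0`. [folklore] -/
theorem constantCoeff_eq_zero (Fs : Fin 2 → MvPolynomial (Fin 5) k)
    (hF₀ : Fs 0 = X 4 - X 1 ^ 2 - X 0 ^ 3) (hF₁ : Fs 1 = X 2 ^ 2 + X 4 ^ 3 + X 0 ^ 11 + X 3 ^ 7) :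
    ∀ l : Fin 2, constantCoeff (Fs l) = 0 := by
  intro l
  fin_cases l
  · simp [hF₀, constantCoeff_X]
  · simp [hF₁, constantCoeff_X]

/-- `Set.range Fs` as the list set `{r | r ∈ [Fs 0, Fs 1]}` (the shape of `T11SpecimenDoor.cmClause_of_isMaximal`). [folklore] -/
theorem range_eq_list (Fs : Fin 2 → MvPolynomial (Fin 5) k) : Set.range Fs = {r : MvPolynomial (Fin 5) k | r ∈ [Fs 0, Fs 1]} := by
  ext r
  simp only [Set.mem_range, Set.mem_setOf_eq, List.mem_cons, List.not_mem_nil, or_false]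
  constructor
  · rintro ⟨i, rfl⟩
    fin_cases i
    · exact Or.inl rfl
    · exact Or.inr rfl
  · rintro (rfl | rfl)
    exacts [⟨0, rfl⟩, ⟨1, rfl⟩]

/-- **THE SPECIMEN DOOR FOR `T₁₁⁺`, ANY PRIME `p ∉ {2, 3, 7, 11}`, MODULO POINT-FIXABILITY AT THE ORIGIN.** For
`X = Spec k[x,y,z,w,Φ]/(Φ − y² − x³, z² + Φ³ + x¹¹ + w⁷)`, `char k = p`: if the local ring at the origin is point-fixable (`h0`), then there
are a scheme `X'` and a proper birational `π : X' ⟶ X` such that every stalk of `X'` is a domain in which every system of parameters is weakly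
regular and generates a Frobenius-closed ideal (generic door `SpecimenDoor.fInjectiveMacaulayfication_of_originPointFixable` ∘ `T11PlusPrime` ∘
`QuotientOriginMaximal` ∘ §3 ∘ `T11SpecimenDoor.cmClause_of_isMaximal`). [folklore assembly] -/
theorem fInjectiveMacaulayfication_T11plus_of_ne (p : ℕ) [Fact p.Prime] (hp2 : p ≠ 2) (hp3 : p ≠ 3) (hp7 : p ≠ 7) (hp11 : p ≠ 11)
    (k : Type) [Field k] [CharP k p] (Fs : Fin 2 → MvPolynomial (Fin 5) k)
    (hF₀ : Fs 0 = X 4 - X 1 ^ 2 - X 0 ^ 3) (hF₁ : Fs 1 = X 2 ^ 2 + X 4 ^ 3 + X 0 ^ 11 + X 3 ^ 7)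
    (h0 : ∀ b : Spec (.of (MvPolynomial (Fin 5) k ⧸ Ideal.span (Set.range Fs))),
      b.asIdeal = Ideal.span (Set.range fun j : Fin 5 => Ideal.Quotient.mk (Ideal.span (Set.range Fs)) (X j)) →
      ∃ (m : ℕ) (c : Fin m → (Spec (.of (MvPolynomial (Fin 5) k ⧸ Ideal.span (Set.range Fs)))).presheaf.stalk b),
        Ideal.span (Set.range c) ≠ ⊥ ∧
        (Ideal.span (Set.range c)).radical =
          IsLocalRing.maximalIdeal ((Spec (.of (MvPolynomial (Fin 5) k ⧸ Ideal.span (Set.range Fs)))).presheaf.stalk b) ∧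
        ∀ (j : Fin m) (𝔔 : PrimeSpectrum (Literature.AlgebraicGeometry.Resolution.blowupAlgebra (Ideal.span (Set.range c)) (c j))),
          𝔔.asIdeal.comap (algebraMap ((Spec (.of (MvPolynomial (Fin 5) k ⧸ Ideal.span (Set.range Fs)))).presheaf.stalk b)
            (Literature.AlgebraicGeometry.Resolution.blowupAlgebra (Ideal.span (Set.range c)) (c j))) =
            IsLocalRing.maximalIdeal ((Spec (.of (MvPolynomial (Fin 5) k ⧸ Ideal.span (Set.range Fs)))).presheaf.stalk b) →
          IsDomain (Localization.AtPrime 𝔔.asIdeal) ∧ ∀ d : ℕ, ringKrullDim (Localization.AtPrime 𝔔.asIdeal) = d →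
            ∀ s : Fin d → Localization.AtPrime 𝔔.asIdeal, (Ideal.span (Set.range s)).radical.IsMaximal →
              RingTheory.Sequence.IsWeaklyRegular (Localization.AtPrime 𝔔.asIdeal) (List.ofFn s) ∧
              ∀ y : Localization.AtPrime 𝔔.asIdeal, (∃ e : ℕ, y ^ p ^ e ∈
                Ideal.span ((fun z : Localization.AtPrime 𝔔.asIdeal => z ^ p ^ e) ''
                  (Ideal.span (Set.range s) : Set (Localization.AtPrime 𝔔.asIdeal)))) → y ∈ Ideal.span (Set.range s)) :
    ∃ (X' : Scheme.{0}) (π : X' ⟶ (Spec (.of (MvPolynomial (Fin 5) k ⧸ Ideal.span (Set.range Fs))))), IsProper π ∧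
      Literature.AlgebraicGeometry.Resolution.IsBirational π ∧
      ∀ x : X', IsDomain (X'.presheaf.stalk x) ∧ ∀ d : ℕ, ringKrullDim (X'.presheaf.stalk x) = d →
        ∀ s : Fin d → X'.presheaf.stalk x, (Ideal.span (Set.range s)).radical.IsMaximal →
          RingTheory.Sequence.IsWeaklyRegular (X'.presheaf.stalk x) (List.ofFn s) ∧
          ∀ y : X'.presheaf.stalk x, (∃ e : ℕ, y ^ p ^ e ∈
            Ideal.span ((fun z : X'.presheaf.stalk x => z ^ p ^ e) '' (Ideal.span (Set.range s) : Set (X'.presheaf.stalk x)))) →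
            y ∈ Ideal.span (Set.range s) := by
  obtain ⟨hprime, -⟩ := T11PlusPrime.t11plus_prime_and_X_ne_zero k Fs hF₀ hF₁
  exact SpecimenDoor.fInjectiveMacaulayfication_of_originPointFixable p Fact.out k 5 2 Fs hprime
    (QuotientOriginMaximal.isMaximal_span_range_mk_X k Fs (constantCoeff_eq_zero Fs hF₀ hF₁))
    (t11Plus_hoff_of_ne p hp2 hp3 hp7 hp11 k Fs hF₀ hF₁)
    (fun Q hQ => T11SpecimenDoor.cmClause_of_isMaximal (Fs 0) (Fs 1) hF₀ hF₁ (Set.range Fs) (range_eq_list Fs) Q hQ) h0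

/-- **THE SPECIMEN DOOR FOR `T₁₁⁺` AT `p = 5`** (the twin of `T11SpecimenDoor.fInjectiveMacaulayfication_T11plus_char7`): the crux conclusion for
`X = T₁₁⁺/k`, `char k = 5`, modulo `h0` = point-fixability of the origin (`PFix₅`), which the road-B instance at `p = 5` discharges through
`T11PlusOriginTransportStalk.t11Plus_h0_of_hypersurface_h0 (p := 5)`. [folklore assembly] -/
theorem fInjectiveMacaulayfication_T11plus_char5_of_h0 (k : Type) [Field k] [CharP k 5] (Fs : Fin 2 → MvPolynomial (Fin 5) k)
    (hF₀ : Fs 0 = X 4 - X 1 ^ 2 - X 0 ^ 3) (hF₁ : Fs 1 = X 2 ^ 2 + X 4 ^ 3 + X 0 ^ 11 + X 3 ^ 7)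
    (h0 : ∀ b : Spec (.of (MvPolynomial (Fin 5) k ⧸ Ideal.span (Set.range Fs))),
      b.asIdeal = Ideal.span (Set.range fun j : Fin 5 => Ideal.Quotient.mk (Ideal.span (Set.range Fs)) (X j)) →
      ∃ (m : ℕ) (c : Fin m → (Spec (.of (MvPolynomial (Fin 5) k ⧸ Ideal.span (Set.range Fs)))).presheaf.stalk b),
        Ideal.span (Set.range c) ≠ ⊥ ∧
        (Ideal.span (Set.range c)).radical =
          IsLocalRing.maximalIdeal ((Spec (.of (MvPolynomial (Fin 5) k ⧸ Ideal.span (Set.range Fs)))).presheaf.stalk b) ∧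
        ∀ (j : Fin m) (𝔔 : PrimeSpectrum (Literature.AlgebraicGeometry.Resolution.blowupAlgebra (Ideal.span (Set.range c)) (c j))),
          𝔔.asIdeal.comap (algebraMap ((Spec (.of (MvPolynomial (Fin 5) k ⧸ Ideal.span (Set.range Fs)))).presheaf.stalk b)
            (Literature.AlgebraicGeometry.Resolution.blowupAlgebra (Ideal.span (Set.range c)) (c j))) =
            IsLocalRing.maximalIdeal ((Spec (.of (MvPolynomial (Fin 5) k ⧸ Ideal.span (Set.range Fs)))).presheaf.stalk b) →
          IsDomain (Localization.AtPrime 𝔔.asIdeal) ∧ ∀ d : ℕ, ringKrullDim (Localization.AtPrime 𝔔.asIdeal) = d →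
            ∀ s : Fin d → Localization.AtPrime 𝔔.asIdeal, (Ideal.span (Set.range s)).radical.IsMaximal →
              RingTheory.Sequence.IsWeaklyRegular (Localization.AtPrime 𝔔.asIdeal) (List.ofFn s) ∧
              ∀ y : Localization.AtPrime 𝔔.asIdeal, (∃ e : ℕ, y ^ 5 ^ e ∈
                Ideal.span ((fun z : Localization.AtPrime 𝔔.asIdeal => z ^ 5 ^ e) ''
                  (Ideal.span (Set.range s) : Set (Localization.AtPrime 𝔔.asIdeal)))) → y ∈ Ideal.span (Set.range s)) :
    ∃ (X' : Scheme.{0}) (π : X' ⟶ (Spec (.of (MvPolynomial (Fin 5) k ⧸ Ideal.span (Set.range Fs))))), IsProper π ∧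
      Literature.AlgebraicGeometry.Resolution.IsBirational π ∧
      ∀ x : X', IsDomain (X'.presheaf.stalk x) ∧ ∀ d : ℕ, ringKrullDim (X'.presheaf.stalk x) = d →
        ∀ s : Fin d → X'.presheaf.stalk x, (Ideal.span (Set.range s)).radical.IsMaximal →
          RingTheory.Sequence.IsWeaklyRegular (X'.presheaf.stalk x) (List.ofFn s) ∧
          ∀ y : X'.presheaf.stalk x, (∃ e : ℕ, y ^ 5 ^ e ∈
            Ideal.span ((fun z : X'.presheaf.stalk x => z ^ 5 ^ e) '' (Ideal.span (Set.range s) : Set (X'.presheaf.stalk x)))) →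
            y ∈ Ideal.span (Set.range s) :=
  haveI : Fact (Nat.Prime 5) := ⟨by norm_num⟩
  fInjectiveMacaulayfication_T11plus_of_ne 5 (by norm_num) (by norm_num) (by norm_num) (by norm_num) k Fs hF₀ hF₁ h0

end Summit.ResolutionOfSingularities.ResolutionOfSingularities.Theorems.FInjectiveMacaulayfication.T11SpecimenDoorGeneric

end
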